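import Summits.BirchSwinnertonDyer.BirchSwinnertonDyer.Theorems.ManinLocalTwoThreePinningOneHundred
import Summits.BirchSwinnertonDyer.BirchSwinnertonDyer.Theorems.ManinLocalTwoThreePinningKernelRows
import Summits.BirchSwinnertonDyer.BirchSwinnertonDyer.Theorems.ManinLocalTwoThreeEtaCertificateSparse
import Summits.BirchSwinnertonDyer.BirchSwinnertonDyer.Theorems.ManinLocalTwoThreeOddTwistRootFormTransport
import Summits.BirchSwinnertonDyer.BirchSwinnertonDyer.Theorems.ManinLocalTwoThreeEtaIdentitiesTwenty
import Summits.BirchSwinnertonDyer.BirchSwinnertonDyer.Theorems.ManinLocalTwoThreeNonVacuityTwenty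
import Summits.BirchSwinnertonDyer.BirchSwinnertonDyer.Theorems.Rank1ResidualIntModelReduction
import Literature.NumberTheory.EllipticCurves.CuspFormTwist
import Literature.NumberTheory.EllipticCurves.RootNumberTwistProofs
import HarnessLib

/-!
# `|c| = 1` on `X₀(100)` — UNCONDITIONALLY: the level `100 = 2²·5²` of BOTH the crux C2's domain (`2² ∣ 100`) and the
# residual C5's domain (`5² ∣ 100`); the class `100a = 20a ⊗ χ₅` by the ROOT-FORM TRANSPORT at `p = 5`

Cell bsd-f2-manin, route `ManinLocalTwoThree` (crux C2 `ManinOddAtFour`, stmt-BirchSwinnertonDyer-22967; `--supports` helper), LEAD p1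
gen 26.  The capstone of the level-`100` chain:

* §1 THE ROW.  an g54's FACT-FREE kernel pinning `PinningOneHundred.pinning` (`2126 • D.f = Σ_j (yNew)_j • C_j` on the 24-quotient
  `η`-basis of `M₂(Γ₀(100))`, ONE surviving certificate `100a`) is turned into the NEWFORM ROW
  **`f_eq_charTwist_twenty (D) : D.f = φ₂₀ ⊗ χ₅`** (`φ₂₀ = η(2τ)²η(10τ)² = cuspFormEtaProductTwenty`, `χ₅ = (·/5)`), by an g55's
  row lemma `PinningKernel.eq_of_smul_eq_sum_of_row`: the integer identity `2126·(n/5)·aₙ(φ₂₀) = Σ_j y_j·tabs_j[n]` for `n < 60`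
  (kernel `decide`), the sparse `η`-certificate of `φ₂₀` to depth `60`, and Shimura's `aₙ(f ⊗ χ) = χ(n)aₙ(f)` (`cuspCoeff_charTwist`).
* §2 THE ROOT.  `20a1 = [−2, 0, −4, 0, 0]` (the tree's `W₀` of `…NeronSqueezeTwenty`) is MULTIPLICATIVE at `5` (`5 ∣ Δ = −6400`,
  `5 ∤ c₄ = −176`; `IntModel.hasMultiplicativeReductionAtPrime_of_intModel`), and p2/p3's analytic squeeze
  `EtaIdentitiesTwenty.periodLatticeLe_twenty` gives `Λ(φ₂₀) ⊆ Λ_Néron(20a1)`.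
* §3 THE HEADLINE.  p3's engine THEOREM 68.A without a root datum (`OddTwistRootForm.abs_maninConstant_eq_one_of_rootForm_charTwist_eq`,
  Stevens (5.2) PROVED + `Γ₀` twisting + Néron squeeze) at `p = 5`:
  **`abs_maninConstant_eq_one_oneHundred (W) [IsElliptic] [IsGloballyMinimal] (D : ModularParametrizationData W 100) (hopt) :
  |D.maninConstant| = 1`** — hence `2 ∤ c` (C2's body at `N = 100` with NONE of the item's hypotheses: no Mazur, Abbes–Ullmo,
  Česnavičius, modularity, CDT), `5 ∤ c` (the residual C5's body at `N = 100`), and no prime divides `c`.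

HONEST FRAMING: unconditional (standard axioms); LEVEL 100 joins the complete levels.  The `∀ N` cruxes C2/C3/C5, Manin's conjecture
and BSD are NOT proved; item 22967 stays OPEN as filed.  No definition of a `Prop`, no named fact, no sorry; the two `List ℤ` tables
are data. [cite: CremonaAlgorithms1997, §2.10, Table 1 (100a1, 20a1)] [cite: Shimura1971, Prop. 3.64]
[cite: Stevens1989, Lemma (5.2) p. 96, Lemma (5.4) p. 97] [cite: AgasheRibetStein2006, §§1–2] [cite: Koehler2011, §2.1]
-/

set_option autoImplicit false
-- lint-debt: the directory name repeats the summit name (sibling precedent `ManinLocalTwoThreeManinConstantOneTwentySix.lean`)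
set_option linter.dupNamespace false

noncomputable section

open Complex
open UpperHalfPlane hiding I
open scoped MatrixGroups ModularForm
open ModularForm CongruenceSubgroup PowerSeries
open Literature.NumberTheory.ModularForms
open Literature.NumberTheory.EllipticCurves Literature.NumberTheory.EllipticCurves.ModularForms

namespace Summit.BirchSwinnertonDyer.BirchSwinnertonDyer.Theorems.ManinLocalTwoThree.LevelOneHundred

open Summit.BirchSwinnertonDyer.BirchSwinnertonDyer.Theorems.ManinLocalTwoThree
open Summit.BirchSwinnertonDyer.BirchSwinnertonDyer.Rank1Residual.IntModel
open BracketSturm PinningKernel PinningOneHundred OddTwistRootForm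

set_option maxHeartbeats 4000000
set_option maxRecDepth 16384

variable {W : WeierstrassCurve ℚ} [W.IsElliptic]

/-! ## §1 The row `100a = 20a ⊗ χ₅` from the kernel pinning -/

/-- Coefficient table of `φ₂₀ = η(2τ)²η(10τ)² = cuspFormEtaProductTwenty` (`= aₙ(20a)`) to depth `60`. [cite: Koehler2011, §2.1] -/
def tab20 : List ℤ :=
  [0, 1, 0, -2, 0, -1, 0, 2, 0, 1, 0, 0, 0, 2, 0, 2, 0, -6, 0, -4, 0, -4, 0, 6, 0, 1, 0, 4, 0, 6, 0, -4, 0, 0, 0, -2, 0, 2, 0, -4, 0, 6, 0, -10, 0, -1, 0, -6, 0, -3, 0, 12, 0, -6, 0, 0, 0, 8, 0, 12]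

/-- `(n/5)·aₙ(φ₂₀)` to depth `60` — the newform row `100a` (`= (20a)^{χ₅}`). [cite: CremonaAlgorithms1997, Table 1 (100a)] -/
def tabT : List ℤ :=
  [0, 1, 0, 2, 0, 0, 0, -2, 0, 1, 0, 0, 0, -2, 0, 0, 0, 6, 0, -4, 0, -4, 0, -6, 0, 0, 0, -4, 0, 6, 0, -4, 0, 0, 0, 0, 0, -2, 0, -4, 0, 6, 0, 10, 0, 0, 0, 6, 0, -3, 0, 12, 0, 6, 0, 0, 0, -8, 0, 12]

/-- `Σ δ·r_δ = 24·1` for `φ₂₀` (order `1` at `i∞`). [cite: Koehler2011, §2.1] -/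
theorem hS20 : ∑ δ ∈ (20 : ℕ).divisors, (δ : ℤ) * expFn [(2, 2), (10, 2)] δ = 24 * (1 : ℕ) := by
  decide

/-- Sparse table certificate of `φ₂₀` to depth `60`. [cite: Koehler2011, §2.1] -/
theorem hcertPhi20 : mulList 60 tab20 (etaDenListSparse 60 20 (expFn [(2, 2), (10, 2)])) =
    etaNumListSparse 60 20 (expFn [(2, 2), (10, 2)]) 1 := by
  decide +kernel

/-- The twist identity `tabT[n] = (n/5)·tab20[n]`, `n < 60`. [folklore] -/
theorem hTw : ∀ n < 60, tabT.getD n 0 = legendreSym 5 n * tab20.getD n 0 := by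
  decide +kernel

/-- **Row identity `100a`**: `2126·tabT[n] = Σ_j (yNew)_j·tabs_j[n]`, `n < 60` — the kernel's pinned combination IS the
`χ₅`-twist of `φ₂₀` on the certified window. [cite: CremonaAlgorithms1997, Table 1 (100a, 20a)] -/
theorem hrow : ∀ n < 60, (2126 : ℤ) * tabT.getD n 0 = ∑ j : Fin 24, yNew.getD (j : ℕ) 0 * (tabs j).getD n 0 := by
  decide +kernel

/-- `φ₂₀` pointwise as the `η`-quotient of level `20` with `r₂ = r₁₀ = 2`. [cite: Koehler2011, §1] -/
theorem phi20_eq_etaQuotient (τ : ℍ) : cuspFormEtaProductTwenty τ = etaQuotient 20 (expFn [(2, 2), (10, 2)]) τ := by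
  rw [LevelTwenty.etaQuotient_eq_etaProductTwenty]
  rfl

/-- **`aₙ(φ₂₀) = tab20[n]`, `n < 60`.** [cite: Koehler2011, §2.1] -/
theorem tab20_eq_cuspCoeff : ∀ n < 60, ((tab20.getD n 0 : ℤ) : ℂ) = cuspCoeff cuspFormEtaProductTwenty n :=
  qExpansion_coeff_eq_of_etaCertificateSparse_cuspForm cuspFormEtaProductTwenty (expFn [(2, 2), (10, 2)])
    phi20_eq_etaQuotient 1 hS20 tab20 hcertPhi20

/-- **`aₙ(φ₂₀ ⊗ χ₅) = tabT[n]` for `n < 60`**, read in `M₂(Γ₀(100))`. [cite: Shimura1971, Prop. 3.64] -/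
theorem tabT_eq_modCoef_charTwist [Fact (Nat.Prime 5)] :
    ∀ n < 60, ((tabT.getD n 0 : ℤ) : ℂ) = modCoefₗ 100 2 n (ModularFormClass.modularForm
      (charTwist 100 (⟨5, rfl⟩ : 20 ∣ 100) (⟨4, rfl⟩ : 5 ^ 2 ∣ 100) (isQuadratic_quadraticChar_ringHomComp 5) cuspFormEtaProductTwenty)) := by
  intro n hn
  have hc : ((tabT.getD n 0 : ℤ) : ℂ) = ((legendreSym 5 n : ℤ) : ℂ) * ((tab20.getD n 0 : ℤ) : ℂ) := by
    exact_mod_cast hTw n hn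
  rw [modCoefₗ_modularForm, cuspCoeff_charTwist 100 _ _ (isQuadratic_quadraticChar_ringHomComp 5)
    (isPrimitive_quadraticChar_ringHomComp 5 (by norm_num)), quadraticChar_ringHomComp_apply_natCast, ← tab20_eq_cuspCoeff n hn]
  exact hc

/-- **LEVEL 100: THE ROW.**  For every `X₀(100)`-datum `D` of an elliptic `W/ℚ`: `D.f = φ₂₀ ⊗ χ₅` — an EXPLICIT root form, no root
datum, no modularity input. [cite: CremonaAlgorithms1997, §2.10, Table 1 (100a, 20a)] [cite: Shimura1971, Prop. 3.64] -/
theorem f_eq_charTwist_twenty [Fact (Nat.Prime 5)] (D : ModularParametrizationData W 100) :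
    D.f = charTwist 100 (⟨5, rfl⟩ : 20 ∣ 100) (⟨4, rfl⟩ : 5 ^ 2 ∣ 100) (isQuadratic_quadraticChar_ringHomComp 5)
      cuspFormEtaProductTwenty := by
  haveI : FiniteDimensional ℂ (ModularForm (Gamma0 100) 2) := Module.finite_of_finrank_eq_succ finrank_modularForm_two
  obtain ⟨C, hC, -, hpin⟩ := pinning D
  have ht := tables_of_etaCerts 100 60 (fun i : Fin 24 ↦ expFn (Ls[(i : ℕ)]).1) (fun i ↦ shifts i) tabs C hC hshift hcert
  exact cuspForm_eq_of_modularForm_eq (eq_of_smul_eq_sum_of_row C tabs duals 35716800 ht hlen hdual (by norm_num)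
    finrank_modularForm_two _ tabT tabT_eq_modCoef_charTwist 2126 (by decide) yNew hpin hrow)

/-- **All coefficients**: `aₙ(D.f) = (n/5)·aₙ(φ₂₀)` for every `n` and every `X₀(100)`-datum. [cite: Shimura1971, Prop. 3.64] -/
theorem cuspCoeff_f_eq_legendre_mul_phi20 [Fact (Nat.Prime 5)] (D : ModularParametrizationData W 100) (n : ℕ) :
    cuspCoeff D.f n = (legendreSym 5 n : ℂ) * cuspCoeff cuspFormEtaProductTwenty n := by
  rw [f_eq_charTwist_twenty D, cuspCoeff_charTwist 100 _ _ (isQuadratic_quadraticChar_ringHomComp 5)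
    (isPrimitive_quadraticChar_ringHomComp 5 (by norm_num)), quadraticChar_ringHomComp_apply_natCast]

/-! ## §2 The root curve `20a1 = [−2, 0, −4, 0, 0]` is multiplicative at `5` -/

/-- The tree's integral model of `20a1` is `[−2, 0, −4, 0, 0]`. [folklore] -/
theorem integralModelInt_W20 [(⟨-2, 0, -4, 0, 0⟩ : WeierstrassCurve ℚ).IsGloballyMinimal] :
    WeierstrassCurve.integralModelInt (⟨-2, 0, -4, 0, 0⟩ : WeierstrassCurve ℚ) = ⟨-2, 0, -4, 0, 0⟩ :=
  integralModelInt_eq_of_map_eq _ ((map_mk_int (-2) 0 (-4) 0 0).trans NonVacuityTwenty.mk_W20_eq_cast.symm)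

/-- **`20a1` has multiplicative reduction at `5`** (`5 ∣ Δ = −6400 = −2⁸·5²`, `5 ∤ c₄ = −176`).
[cite: SilvermanAEC2009, VII.5 Prop. 5.1(b)] [cite: CremonaAlgorithms1997, Table 1 (20a1)] -/
theorem hasMultiplicativeReductionAtPrime_five_W20 [Fact (Nat.Prime 5)] :
    (⟨-2, 0, -4, 0, 0⟩ : WeierstrassCurve ℚ).HasMultiplicativeReductionAtPrime 5 := by
  haveI := NeronSqueezeTwenty.isElliptic_W20
  haveI := NeronSqueezeTwenty.isGloballyMinimal_W20
  exact hasMultiplicativeReductionAtPrime_of_intModel (W := (⟨-2, 0, -4, 0, 0⟩ : WeierstrassCurve ℚ))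
    integralModelInt_W20 5 (by decide) (by decide)

/-! ## §3 The headline: `|c| = 1` on `X₀(100)`, unconditionally -/

/-- **LEVEL 100 COMPLETE — `|c| = 1` for every globally minimal elliptic `W/ℚ` and every `X₀(100)`-datum with the lattice
clause `Λ_W = c·Λ_f`.**  Row `100a`: `D.f = φ₂₀ ⊗ χ₅`, root squeeze `Λ(φ₂₀) ⊆ Λ_Néron(20a1)`, `20a1` multiplicative at `5`, closed
by the odd-twist ROOT-FORM transport at `p = 5` (Stevens (5.2) PROVED + `Γ₀` twisting + Néron squeeze).  No root datum, no
modularity, no CDT, no printed Manin fact. [cite: Stevens1989, Lemma (5.2) p. 96, Lemma (5.4) p. 97] [cite: AgasheRibetStein2006, §§1–2]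
[cite: CremonaAlgorithms1997, Table 1 (100a1, 20a1)] -/
theorem abs_maninConstant_eq_one_oneHundred (W : WeierstrassCurve ℚ) [W.IsElliptic] [W.IsGloballyMinimal]
    (D : ModularParametrizationData W 100) (hopt : ∀ z ∈ D.L.lattice, ∃ w ∈ periodLattice D.f, z = D.c * w) :
    |D.maninConstant| = 1 := by
  haveI h5 : Fact (Nat.Prime 5) := ⟨by norm_num⟩
  obtain ⟨L₁, hg2, hg3, hle⟩ := EtaIdentitiesTwenty.periodLatticeLe_twenty
  haveI := NeronSqueezeTwenty.isElliptic_W20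
  haveI := NeronSqueezeTwenty.isGloballyMinimal_W20
  exact abs_maninConstant_eq_one_of_rootForm_charTwist_eq (p := 5) (by norm_num) (isQuadratic_quadraticChar_ringHomComp 5)
    (isPrimitive_quadraticChar_ringHomComp 5 (by norm_num)) cuspFormEtaProductTwenty (⟨-2, 0, -4, 0, 0⟩ : WeierstrassCurve ℚ) L₁
    (NeronSqueezeTwenty.isNeronLatticeOf_W20 hg2 hg3) hle (Or.inr hasMultiplicativeReductionAtPrime_five_W20) W D _ _
    (f_eq_charTwist_twenty D) hopt

/-- **Corollary: no integer `q` with `|q| ≠ 1` — in particular neither `2` nor `5` nor any prime — divides the Manin constant of a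
lattice-optimal `X₀(100)`-datum.** [folklore] -/
theorem not_dvd_maninConstant_oneHundred (W : WeierstrassCurve ℚ) [W.IsElliptic] [W.IsGloballyMinimal]
    (D : ModularParametrizationData W 100) (hopt : ∀ z ∈ D.L.lattice, ∃ w ∈ periodLattice D.f, z = D.c * w)
    {q : ℤ} (hq : q.natAbs ≠ 1) : ¬ q ∣ D.maninConstant := by
  intro h
  have h1 := abs_maninConstant_eq_one_oneHundred W D hopt
  have hn : D.maninConstant.natAbs = 1 := by
    rw [Int.abs_eq_natAbs] at h1
    exact_mod_cast h1
  have h2 : q.natAbs ∣ 1 := hn ▸ Int.natAbs_dvd_natAbs.mpr h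
  exact hq (Nat.dvd_one.mp h2)

/-- **`2 ∤ c` on `X₀(100)`, UNCONDITIONALLY** — the body of the crux C2 `ManinOddAtFour` at `N = 100` (`2² ∣ 100`) with none of its
fact hypotheses. [cite: AgasheRibetStein2006, §§1–2] -/
theorem not_two_dvd_maninConstant_oneHundred (W : WeierstrassCurve ℚ) [W.IsElliptic] [W.IsGloballyMinimal]
    (D : ModularParametrizationData W 100) (hopt : ∀ z ∈ D.L.lattice, ∃ w ∈ periodLattice D.f, z = D.c * w) :
    ¬ (2 : ℤ) ∣ D.maninConstant :=
  not_dvd_maninConstant_oneHundred W D hopt (by decide)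

/-- **`5 ∤ c` on `X₀(100)`, UNCONDITIONALLY** — the body of the residual C5 `ManinPrimeToAdditiveFiveLe` at `N = 100`, `p = 5`
(`5² ∣ 100`) with none of its fact hypotheses. [cite: AgasheRibetStein2006, §§1–2] -/
theorem not_five_dvd_maninConstant_oneHundred (W : WeierstrassCurve ℚ) [W.IsElliptic] [W.IsGloballyMinimal]
    (D : ModularParametrizationData W 100) (hopt : ∀ z ∈ D.L.lattice, ∃ w ∈ periodLattice D.f, z = D.c * w) :
    ¬ (5 : ℤ) ∣ D.maninConstant :=
  not_dvd_maninConstant_oneHundred W D hopt (by decide)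

/-- **C2's inner clause at `N = 100` in the item's literal shape**: `2² ∣ 100`, and every lattice-optimal `X₀(100)`-datum of every
globally minimal elliptic curve has `|c| = 1` and `2 ∤ c`. [cite: CremonaAlgorithms1997, Table 1 (100a1)] -/
theorem maninOddAtFour_oneHundred : 2 ^ 2 ∣ 100 ∧
    ∀ (W : WeierstrassCurve ℚ) [W.IsElliptic] [W.IsGloballyMinimal] (D : ModularParametrizationData W 100),
      (∀ z ∈ D.L.lattice, ∃ w ∈ periodLattice D.f, z = D.c * w) →
        |D.maninConstant| = 1 ∧ ¬ (2 : ℤ) ∣ D.maninConstant :=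
  ⟨by norm_num, fun W _ _ D hopt ↦
    ⟨abs_maninConstant_eq_one_oneHundred W D hopt, not_two_dvd_maninConstant_oneHundred W D hopt⟩⟩

/-- **The sieve truth row read back**: every curve with an `X₀(100)`-datum has `a₂(W) = 0 = a₅(W)` (additive at `2` and `5` in the
`L`-coefficient sense) and `a₃(W) = 2`. [cite: CremonaAlgorithms1997, Table 1 (100a1)] -/
theorem lFunction_two_five_three (D : ModularParametrizationData W 100) :
    W.LFunction 2 = 0 ∧ W.LFunction 5 = 0 ∧ W.LFunction 3 = 2 := by
  haveI : FiniteDimensional ℂ (ModularForm (Gamma0 100) 2) := Module.finite_of_finrank_eq_succ finrank_modularForm_two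
  obtain ⟨C, hC, htruth, -⟩ := pinning D
  have hl : stages.map Prod.fst = [2, 5, 3, 7, 19, 13, 11, 17, 23, 29, 31] := by decide
  rw [hl] at htruth
  have h2 := congrArg (fun l : List (ℕ × ℤ) ↦ (l.getD 0 (0, 0)).2) htruth
  have h5 := congrArg (fun l : List (ℕ × ℤ) ↦ (l.getD 1 (0, 0)).2) htruth
  have h3 := congrArg (fun l : List (ℕ × ℤ) ↦ (l.getD 2 (0, 0)).2) htruth
  exact ⟨by simpa [truth] using h2, by simpa [truth] using h5, by simpa [truth] using h3⟩

end Summit.BirchSwinnertonDyer.BirchSwinnertonDyer.Theorems.ManinLocalTwoThree.LevelOneHundred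

end
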